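import Summits.FinalStateConjecture.FinalStateConjecture.Theorems.ClusterCompletenessAdiabaticMultiKerrILEDZeroSpinFarEnergyBound
import Summits.FinalStateConjecture.FinalStateConjecture.Theorems.ClusterCompletenessAdiabaticMultiKerrILEDLateAssembly
import Summits.FinalStateConjecture.FinalStateConjecture.Theorems.ClusterCompletenessAdiabaticMultiKerrILEDRedShiftLocal
import Summits.FinalStateConjecture.FinalStateConjecture.Theorems.ClusterCompletenessAdiabaticMultiKerrILEDZonePullbackWave
import Summits.FinalStateConjecture.FinalStateConjecture.Theorems.ClusterCompletenessAdiabaticMultiKerrILEDSliceLeafCorrespondence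
import Summits.FinalStateConjecture.FinalStateConjecture.Theorems.ClusterCompletenessAdiabaticMultiKerrILEDBoundedOfIntegralIneq
import HarnessLib

/-!
# Crux `AdiabaticMultiKerrILED`, line `Sketch`: late-time uniform boundedness of the exterior lab
# energy for ONE boosted tails-cut zone of ZERO SPIN (stub `lateEnergyBound_zeroSpin_single`)

Crux item `stmt-FinalStateConjecture-14310`
(`Summit.FinalStateConjecture.FinalStateConjecture.Theses.ClusterCompleteness.AdiabaticMultiKerrILED`),
line `Sketch`, lead c7 wave 3, stub `lateEnergyBound_zeroSpin_single`: for one zero-spin tails-cut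
Kerr zone boosted to lab speed `≤ v₀`, the exterior lab energy of every smooth solution `ψ` of the
patched divergence-form wave equation satisfies `E[ψ](t) ≤ C · E[ψ](0)` for all `t ≥ t₁`.

This is the `N = 1`, `a = 0` instance of c4's assembly `stub_lateAssembly`
(`…Theorems.ClusterCompletenessAdiabaticMultiKerrILEDLateAssembly`), whose proof is ADAPTED here
(it cannot be called: its far-energy hypothesis `hFB` is the general-`N`, all-spins research stub).
The four classical inputs are the landed theorems `stub_redShiftLocal` (hRS), `stub_zonePullbackWave`
(hPB), `stub_sliceLeafCorrespondence` (hSL), `stub_boundedOfIntegralIneq` (hBI); the far-energy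
bound is the landed zero-spin single-zone theorem `singleZoneFarEnergyBound_zeroSpin`; the
finite-time growth bound is `stub_finiteTimeEnergy`. At `N = 1` the pair-separation hypotheses of
the landed helper lemmas are vacuous (`Fin 1` is a subsingleton) and at `a = 0` the spin hypotheses
`|aᵢ| ≤ Mᵢ/2` are trivial. The argument is Dafermos–Rodnianski's red-shift boundedness argument
(arXiv:0811.0354, §3.3.4) run on the lab foliation: split `E[ψ](t)` into the far part
`{r ≥ r₊ + (η/2)M}` (bounded by `C E[ψ](0)` from `t₁` on) and the half-collar
`{r₊ < r ≤ r₊ + ηM/2}`, on which the local red-shift estimate between lab slices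
(`collar_redshift_lab`) gives the lossy integral inequality (`late_integral_inequality`) for the
half-collar quantity `G`, whence `G` is bounded (`hBI`); `late_energy_split`, `late_final_bound` and
`stub_finiteTimeEnergy` at `tₐ = max(t₁, 0)` close the estimate. [folklore]
-/

noncomputable section

-- the doubled `FinalStateConjecture.FinalStateConjecture` path component trips dupNamespace
set_option linter.dupNamespace false

open scoped ContDiff Topology BigOperators ENNReal InnerProductSpace
open Filter Set MeasureTheory Literature.Geometry.Lorentzian
open Summit.FinalStateConjecture.FinalStateConjecture.Cruxes.AdiabaticMultiKerrILED.Sketch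

namespace Summit.FinalStateConjecture.FinalStateConjecture.Theorems

/-- **Late-time uniform boundedness of the exterior lab energy, one boosted tails-cut zone of zero
spin** (stub `lateEnergyBound_zeroSpin_single` of line `Sketch`): there is `v₀ > 0` such that for
every single zero-spin tails-cut Kerr zone boosted to lab speed `≤ v₀ u⁰` there are `t₁, C` with
`E[ψ](t) ≤ C · E[ψ](0)` for all `t ≥ t₁` and all smooth solutions `ψ` of the patched
divergence-form wave equation on `{x⁰ ≥ 0}` outside the horizon — Dafermos–Rodnianski's red-shift
boundedness argument (arXiv:0811.0354, §3.3.4) on the lab foliation, fed by the landed zero-spin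
far-energy bound `singleZoneFarEnergyBound_zeroSpin`, the local red-shift estimate
`stub_redShiftLocal`, the zone pull-back `stub_zonePullbackWave`, the slice/leaf correspondence
`stub_sliceLeafCorrespondence`, the real-variable lemma `stub_boundedOfIntegralIneq` and the
finite-time growth bound `stub_finiteTimeEnergy` (the `N = 1`, `a = 0` specialisation of the proof of
`stub_lateAssembly`). [folklore] -/
theorem lateEnergyBound_zeroSpin_single : ∃ v₀ : ℝ, 0 < v₀ ∧ ∀ (M : Fin 1 → ℝ) (Λ : Fin 1 → lorentzGroup) (p : Fin 1 → E3) (u : Fin 1 → E4) (q : Fin 1 → E4 → E4), (∀ i, u i = (Λ i : E4 ≃L[ℝ] E4) (E4.basisVector 0)) → (∀ i x, q i x = poincareInv (Λ i) (E4.ofTimeSpace 0 (p i)) x) → (∀ i, 0 < M i) → (∀ i, 0 < u i 0 ∧ ‖E4.spatial (u i)‖ ≤ v₀ * u i 0) → ∀ (G : E4 → Fin 4 → Fin 4 → ℝ), (∀ x μ ν, G x μ ν = Minkowski.bilin (E4.basisVector μ) (E4.basisVector ν) - ∑ i, Real.smoothTransition (2 - Kerr.radius 0 (q i x) / (8 *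 M i)) * (2 * Kerr.scalarH (M i) 0 (q i x)) * ((Λ i : E4 ≃L[ℝ] E4) (Kerr.nullVector 0 (q i x))) μ * ((Λ i : E4 ≃L[ℝ] E4) (Kerr.nullVector 0 (q i x))) ν) → ∀ (E : (E4 → ℝ) → ℝ → ENNReal), (∀ φ t, E φ t = ∫⁻ y in {y : E3 | ∀ i, Kerr.rPlus (M i) 0 < Kerr.radius 0 (q i (E4.ofTimeSpace t y))}, ENNReal.ofReal (∑ μ : Fin 4, (fderiv ℝ φ (E4.ofTimeSpace t y) (E4.basisVector μ)) ^ 2)) → ∃ (t₁ : ℝ) (C : NNReal), ∀ ψ : E4 → ℝ, ContDiff ℝ ∞ ψ → (∀ x : E4, 0 ≤ x 0 → (∀ i, Kerr.rPlus (M i) 0 < Kerr.radius 0 (q i x)) → ∑ μ : Fin 4, fderiv ℝ (fun y ↦ ∑ ν : Fin 4, G y μ ν * fderiv ℝ ψ y (E4.basisVector ν)) x (E4.basisVector μ) = 0) → ∀ t : ℝ, t₁ ≤ t → E ψ t ≤ (C : ENNReal) * E ψ 0 := by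
  obtain ⟨v₀, hv₀, HFB⟩ := singleZoneFarEnergyBound_zeroSpin
  refine ⟨min v₀ 2⁻¹, lt_min hv₀ (by norm_num), ?_⟩
  intro M Λ p u q hu hq hM hv G hG E hE
  -- ### thresholds; at `N = 1`, `a = 0` the spin and separation hypotheses of the helpers are trivial
  have ha₂ : ∀ i : Fin 1, |(0 : ℝ)| ≤ 2⁻¹ * M i := fun i ↦ by
    rw [abs_zero]; exact mul_nonneg (by norm_num) (hM i).le
  have hv₁ : ∀ i, 0 < u i 0 ∧ ‖E4.spatial (u i)‖ ≤ v₀ * u i 0 := fun i ↦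
    ⟨(hv i).1, (hv i).2.trans (mul_le_mul_of_nonneg_right (min_le_left _ _) (hv i).1.le)⟩
  have hv₂ : ∀ i, 0 < u i 0 ∧ ‖E4.spatial (u i)‖ ≤ 2⁻¹ * u i 0 := fun i ↦
    ⟨(hv i).1, (hv i).2.trans (mul_le_mul_of_nonneg_right (min_le_right _ _) (hv i).1.le)⟩
  have hsep₂ : ∀ i j : Fin 1, i ≠ j → 40 * (M i + M j) ≤ dist (p i) (p j) ∧
      0 < ⟪p i - p j, (u i 0)⁻¹ • E4.spatial (u i) - (u j 0)⁻¹ • E4.spatial (u j)⟫_ℝ :=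
    fun i j hij ↦ absurd (Subsingleton.elim i j) hij
  -- ### red-shift constants, uniform collar parameter, slice/leaf data, far and finite-time bounds
  have hMa : ∀ i, Kerr.IsSubextremal (M i) 0 := fun i ↦
    isSubextremal_of_abs_le_half_mul (hM i) (ha₂ i)
  choose η₀ hη₀ Hrs₁ using fun i ↦ stub_redShiftLocal (M i) 0 (hMa i)
  obtain ⟨η, hη0, hη1, hηM⟩ := exists_pos_le_one_forall_mul_le M η₀ hM hη₀
  choose Crs hCrs HRS using fun i ↦ Hrs₁ i (η * M i) (mul_pos hη0 (hM i)) (hηM i)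
  choose F J κ hJ hκ hF hFslope hSL1 hSL2 hSL3 hSL4 using
    fun i ↦ stub_sliceLeafCorrespondence (Λ i) (p i) (u i) (q i) (hu i) (hq i) (hv i).1 (hv₂ i).2
  obtain ⟨t₁, Cfb, HFB'⟩ := HFB M Λ p u q hu hq hM hv₁ G hG E hE (η / 2) (by positivity)
  obtain ⟨Kft, hKft0, HFT⟩ :=
    stub_finiteTimeEnergy 1 M (fun _ ↦ 0) Λ p u q hu hq hM ha₂ hv₂ hsep₂ G hG E hE
  -- ### constants
  have hu1 : ∀ i, 1 ≤ u i 0 := fun i ↦ by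
    have h := one_le_abs_lorentz_apply_zero (Λ i)
    rw [← hu i, abs_of_pos (hv i).1] at h
    exact h
  set U : ℝ := ∑ i, u i 0 with hUdef
  have hU : ∀ i, u i 0 ≤ U := fun i ↦
    Finset.single_le_sum (fun j _ ↦ (hv j).1.le) (Finset.mem_univ i)
  have hU0 : 1 ≤ U := (hu1 0).trans (hU 0)
  set Cs : ℝ := ∑ i, Crs i with hCsdef
  have hCs : ∀ i, Crs i ≤ Cs := fun i ↦
    Finset.single_le_sum (fun j _ ↦ (hCrs j).le) (Finset.mem_univ i)
  have hCs0 : 0 ≤ Cs := Finset.sum_nonneg fun j _ ↦ (hCrs j).le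
  set κs : ℝ := ∑ i, κ i with hκsdef
  have hκs : ∀ i, κ i ≤ κs := fun i ↦
    Finset.single_le_sum (fun j _ ↦ (hκ j).le) (Finset.mem_univ i)
  have hκs0 : 0 ≤ κs := Finset.sum_nonneg fun j _ ↦ (hκ j).le
  set ta : ℝ := max t₁ 0 with hta
  have hta0 : 0 ≤ ta := le_max_right _ _
  have hta1 : t₁ ≤ ta := le_max_left _ _
  set Bc : ℝ := 2 * Cs * U with hBc
  have hBc0 : 0 ≤ Bc := by positivity
  set L : ℝ := Kft * Real.exp (Kft * ta) with hL
  have hL0 : 0 ≤ L := by positivity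
  set k : ℝ := 2 * Cs * U * ((1 : ℕ) * κs) * Cfb with hk
  have hk0 : 0 ≤ k := by positivity
  set Cfin : ℝ := (Cfb : ℝ) + κs * (10 * ((Bc + 1) + 1)) * (κs * L + k) + 1 with hCfin
  have hCfin0 : 0 < Cfin := by positivity
  refine ⟨ta, Real.toNNReal Cfin, fun ψ hψ hsol t ht ↦ ?_⟩
  -- ### one solution
  have ht0 : 0 ≤ t := hta0.trans ht
  have htt₁ : t₁ ≤ t := hta1.trans ht
  by_cases htop : E ψ 0 = ⊤
  · have hC0 : (Real.toNNReal Cfin : ℝ≥0∞) ≠ 0 := by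
      exact_mod_cast (Real.toNNReal_pos.mpr hCfin0).ne'
    rw [htop, ENNReal.mul_top hC0]
    exact le_top
  have hψ1 : ContDiff ℝ 1 ψ := by have := contDiff_infty.1 hψ 1; exact_mod_cast this
  set Φ : Fin 1 → E4 → ℝ := fun i w ↦ ψ ((Λ i : E4 ≃L[ℝ] E4) w + E4.ofTimeSpace 0 (p i)) with hΦ
  have hΦs : ∀ i, ContDiff ℝ ∞ (Φ i) := fun i ↦
    hψ.comp ((((Λ i : E4 ≃L[ℝ] E4) : E4 →L[ℝ] E4).contDiff).add contDiff_const)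
  have hΦ1 : ∀ i, ContDiff ℝ 1 (Φ i) := fun i ↦ by
    have := contDiff_infty.1 (hΦs i) 1; exact_mod_cast this
  have hΦ2 : ∀ i, ContDiff ℝ 2 (Φ i) := fun i ↦ by
    have := contDiff_infty.1 (hΦs i) 2; exact_mod_cast this
  have HPBψ : ∀ (i : Fin 1) (z : E4), 0 ≤ ((Λ i : E4 ≃L[ℝ] E4) z + E4.ofTimeSpace 0 (p i)) 0 →
      Kerr.rPlus (M i) 0 < Kerr.radius 0 z → Kerr.radius 0 z < 8 * M i →
      KerrSchild.waveOperator (KerrSchild.inverseMetric (fun y ↦ 2 * Kerr.scalarH (M i) 0 y)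
        (Kerr.nullVector 0)) (Φ i) z = 0 :=
    fun i ↦ stub_zonePullbackWave M (fun _ ↦ 0) Λ p u q hu hq hM ha₂ hv₂ hsep₂ G hG ψ hψ hsol i
  have hcmp : ∀ i x, ENNReal.ofReal (∑ μ, fderiv ℝ (Φ i) (q i x) (E4.basisVector μ) ^ 2) ≤
      ENNReal.ofReal (κ i) *
        ENNReal.ofReal (∑ μ : Fin 4, (fderiv ℝ ψ x (E4.basisVector μ)) ^ 2) := fun i x ↦ by
    have h := (hSL4 i ψ x (hψ.differentiable (by simp)).differentiableAt).1
    rw [← ENNReal.ofReal_mul (hκ i).le]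
    exact ENNReal.ofReal_le_ofReal h
  have hcmp' : ∀ i x, ENNReal.ofReal (∑ μ : Fin 4, (fderiv ℝ ψ x (E4.basisVector μ)) ^ 2) ≤
      ENNReal.ofReal (κ i) *
        ENNReal.ofReal (∑ μ, fderiv ℝ (Φ i) (q i x) (E4.basisVector μ) ^ 2) := fun i x ↦ by
    have h := (hSL4 i ψ x (hψ.differentiable (by simp)).differentiableAt).2
    rw [← ENNReal.ofReal_mul (hκ i).le]
    exact ENNReal.ofReal_le_ofReal h
  -- ### the lossy integral inequality for the half-collar quantity `G`
  set W : ℝ≥0∞ := (Cfb : ℝ≥0∞) * E ψ 0 with hW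
  have hineq := late_integral_inequality (a := fun _ ↦ 0) hu hq hM ha₂ hv₂ hsep₂ hη1 (κ := κ)
    (C := Crs) hU hu1 hU0 hCs hCs0 hκs hψ1 hΦ1 hcmp (t₁ := t₁) (W := W)
    (fun τ hτ _ ↦ HFB' ψ hψ hsol τ hτ)
    (fun i s₁ s₂ h0 h ↦ collar_redshift_lab (hq i) (hv i).1 (hF i) (hFslope i) (hSL1 i) (hSL2 i)
      (hSL3 i) (hM i) (mul_le_of_le_one_left (hM i).le hη1) (HRS i) (hΦ2 i) (HPBψ i) h0 h)
  set Gf : ℝ → ℝ≥0∞ := fun τ ↦ ∑ i, ∫⁻ y : E3,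
    {z : E4 | Kerr.rPlus (M i) 0 < Kerr.radius 0 z ∧
        Kerr.radius 0 z ≤ Kerr.rPlus (M i) 0 + η * M i / 2}.indicator
      (fun z ↦ ENNReal.ofReal (∑ μ, fderiv ℝ (Φ i) z (E4.basisVector μ) ^ 2))
      (q i (E4.ofTimeSpace τ y)) with hGf
  set B : NNReal := Real.toNNReal Bc + 1 with hB
  have hBco : (B : ℝ≥0∞) = ENNReal.ofReal (Bc + 1) := by
    rw [hB, ENNReal.coe_add, ENNReal.coe_one, ENNReal.ofReal_add hBc0 zero_le_one,
      ENNReal.ofReal_one]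
    rfl
  set Kc : ℝ≥0∞ := ENNReal.ofReal (2 * Cs * U * ((1 : ℕ) * κs)) * W with hKc
  have hGineq : ∀ s₁ s₂ : ℝ, ta ≤ s₁ → s₁ ≤ s₂ →
      Gf s₂ + ∫⁻ s in Set.Ioc s₁ s₂, Gf s ≤
        (B : ℝ≥0∞) * Gf s₁ + Kc * ENNReal.ofReal (1 + (s₂ - s₁)) := by
    intro s₁ s₂ hs₁ hs
    refine (hineq s₁ s₂ hs₁ hs).trans ?_
    rw [hBco, ENNReal.ofReal_add hBc0 zero_le_one, ENNReal.ofReal_one, hKc]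
    gcongr
    exact le_self_add
  -- ### measurability and finiteness of `G`, then the real-variable lemma `hBI`
  have hqc : ∀ i, Continuous (q i) := fun i ↦ by
    rw [show q i = poincareInv (Λ i) (E4.ofTimeSpace 0 (p i)) from funext (hq i)]
    exact continuous_poincareInv _ _
  have hGm : Measurable Gf := by
    refine Finset.measurable_sum _ fun i _ ↦ ?_
    exact measurable_lintegral_comp_slice
      ((measurable_energyDensity (hΦ1 i)).indicator (measurableSet_radius_collar _ _ _).1) (hqc i)
  have hsplit := fun (τ : ℝ) (hτ : 0 ≤ τ) ↦ late_energy_split (a := fun _ ↦ 0) hu hq hM ha₂ hv₂ hsep₂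
    hη1 (fun i ↦ (hκ i).le) hκs le_rfl hψ1 (Φ := Φ) hcmp hcmp' hτ
  have hGE : ∀ τ, 0 ≤ τ → Gf τ ≤ ENNReal.ofReal κs * E ψ τ := fun τ hτ ↦ by
    rw [hE ψ τ]; exact (hsplit τ hτ).2
  have hGfin : ∀ s, ta ≤ s → Gf s ≠ ⊤ := by
    intro s hs
    have hs0 : 0 ≤ s := hta0.trans hs
    refine (lt_of_le_of_lt ((hGE s hs0).trans (mul_le_mul' le_rfl (HFT ψ hψ hsol s hs0))) ?_).ne
    exact ENNReal.mul_lt_top ENNReal.ofReal_lt_top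
      (ENNReal.mul_lt_top ENNReal.ofReal_lt_top (lt_top_iff_ne_top.2 htop))
  have hB1 : 1 ≤ B := by rw [hB]; exact le_add_self
  have hbound := stub_boundedOfIntegralIneq Gf ta B Kc hGm hB1 hGfin hGineq t ht
  -- ### close
  have h1 : E ψ t ≤ (∫⁻ y in {y : E3 | ∀ i, Kerr.rPlus (M i) 0 + η / 2 * M i ≤
      Kerr.radius 0 (q i (E4.ofTimeSpace t y))},
        ENNReal.ofReal (∑ μ : Fin 4, (fderiv ℝ ψ (E4.ofTimeSpace t y) (E4.basisVector μ)) ^ 2)) +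
      ENNReal.ofReal κs * Gf t := by
    rw [hE ψ t]; exact (hsplit t ht0).1
  have h2 : Gf t ≤ 10 * (ENNReal.ofReal (Bc + 1) + 1) * (Gf ta + Kc) := by rw [← hBco]; exact hbound
  have h5 : (∫⁻ y in {y : E3 | ∀ i, Kerr.rPlus (M i) 0 + η / 2 * M i ≤
      Kerr.radius 0 (q i (E4.ofTimeSpace t y))},
        ENNReal.ofReal (∑ μ : Fin 4, (fderiv ℝ ψ (E4.ofTimeSpace t y) (E4.basisVector μ)) ^ 2)) ≤
      ENNReal.ofReal (Cfb : ℝ) * E ψ 0 := by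
    rw [ENNReal.ofReal_coe_nnreal]; exact HFB' ψ hψ hsol t htt₁
  have h6 : Kc = ENNReal.ofReal k * E ψ 0 := by
    rw [hKc, hW, ← mul_assoc, hk,
      ENNReal.ofReal_mul (by positivity : (0 : ℝ) ≤ 2 * Cs * U * ((1 : ℕ) * κs)),
      ENNReal.ofReal_coe_nnreal]
  refine (late_final_bound hκs0 (by positivity) hL0 (Cfb).2 hk0 h1 h2 (hGE ta hta0)
    (HFT ψ hψ hsol ta hta0) h5 h6).trans ?_
  show _ ≤ ENNReal.ofReal Cfin * E ψ 0
  exact mul_le_mul' (ENNReal.ofReal_le_ofReal (by rw [hCfin]; exact (lt_add_one _).le)) le_rfl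

end Summit.FinalStateConjecture.FinalStateConjecture.Theorems

end
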